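import Summits.AnomalousDissipation.AnomalousDissipation.Theorems.TwoAndHalfDTwohalfdNegReductionOffZero
import Summits.AnomalousDissipation.AnomalousDissipation.Theorems.TwoAndHalfDTwohalfdThesisStubPlanarSubLogNoGo
import Summits.AnomalousDissipation.AnomalousDissipation.Theorems.TwoAndHalfDTwohalfdThesisStubEventualLogStrain
import Summits.AnomalousDissipation.AnomalousDissipation.Theorems.TwoAndHalfDTwohalfdThesisStubStrainSqLeEnstrophy
import Summits.AnomalousDissipation.AnomalousDissipation.Theorems.TwoAndHalfDTwohalfdThesisStubPlanarEnstrophyCeiling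
import Literature.Analysis.FluidPDE.TwoHalfSection
import Literature.Analysis.FluidPDE.LerayHopfGalileanTorusMeans
import Literature.Analysis.FluidPDE.LerayHopfTimeSliceTorus
import Literature.Analysis.FluidPDE.LongTimeAverageNonneg

/-!
# O-CERT `stub_witnessWindow` — THE WITNESS WINDOW of an X-witness, in X's own language
# (line `Sketch`, crux stmt-AnomalousDissipation-0206)

Registered assembly stub (section O) of the line `Sketch` (duhamel-release) for the crux
`Summit.AnomalousDissipation.AnomalousDissipation.Theses.TwoAndHalfD.TwohalfdThesis` (= X,
stmt-AnomalousDissipation-0206).  Every X-witness `(f, ν, u₀, u)` — one steady smooth solenoidal mean-zero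
`x₃`-invariant force, `ν_j → 0`, `x₃`-invariant global Leray–Hopf solutions with `ν`-uniformly bounded
`limsup`-mean energy and `limsup`-mean dissipation `≥ ε > 0` — has, for its PLANAR SECTION
`v_j(t) = π_E ∘ u_j(t) ∘ ι`:

* (i) an eventual logarithmic STRAIN floor `c·log(1/ν_j) ≤ ⟨‖∇v_j‖₂⟩` (O1 `stub_planarSubLogNoGo` upgraded
  by subsequence stability, O2 `stub_eventualLogStrain`);
* (ii) an eventual `log²` ENSTROPHY floor `c²·log²(1/ν_j) ≤ ⟨‖∇v_j‖₂²⟩` (Jensen for honest `limsup` means,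
  O3 `stub_strainSqLeEnstrophy`, along the planar Leray–Hopf flow `v_j` of the reduction
  `TwohalfdNeg.ReductionOffZero.stub_reductionOffZero`, identified with the section off `t = 0`);
* (iii) the Alexakis–Doering enstrophy CEILING `⟨‖∇v_j‖₂²⟩ ≤ C·ν_j^{-1/2}` for all `j`
  (O4 `stub_planarEnstrophyCeiling` with `K = sup ‖Δg‖`, `E` the planar energy bound, `C = √(K·√E·E)`).

So the planar flow of a witness must live in the enstrophy window `[c² log²(1/ν), C ν^{-1/2}]`.
Supports stmt-AnomalousDissipation-0206.

## Mathlib / Literature search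

`lean search 'planarProjE_twoHalf_planarSect'` (`TwoHalfSection`), `'longTimeAvgSup_congr_of_eqOn_Ioi'`
(`LerayHopfGalileanTorusMeans`), `'exists_nonneg_forall_norm_le_of_continuous'` (`LerayHopfTimeSliceTorus`),
`'Real.sqrt_mul''` (Mathlib); `lean find`: nothing to adapt.
-/

noncomputable section

-- the summit path AnomalousDissipation/AnomalousDissipation duplicates a namespace component
set_option linter.dupNamespace false

namespace Summit.AnomalousDissipation.AnomalousDissipation.Theorems.TwohalfdThesis

open MeasureTheory Set Filter Topology
open scoped ENNReal NNReal
open Literature.Analysis.FunctionSpaces Literature.Analysis.FluidPDE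
open Summit.AnomalousDissipation.AnomalousDissipation.Theorems.TwohalfdNeg

/-! ## The section's enstrophy is the planar flow's, in the mean -/

/-- **Off `t = 0` the planar section of a `2½`-dimensional family is its planar part, in the `limsup`-mean
ENSTROPHY.**  If `u t = twoHalf (v t) (θ t)` for every `t ≠ 0`, then
`⟨‖∇(π_E ∘ u ∘ ι)‖₂²⟩ = ⟨‖∇v‖₂²⟩` (`planarProjE_twoHalf_planarSect` slice-wise for `t > 0`,
`longTimeAvgSup_congr_of_eqOn_Ioi`). [folklore] -/
theorem longTimeAvgSup_eGradNormSq_planarSection_eq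
    {u : ℝ → UnitAddTorus (Fin 3) → EuclideanSpace ℝ (Fin 3)}
    {v : ℝ → UnitAddTorus (Fin 2) → EuclideanSpace ℝ (Fin 2)} {θ : ℝ → UnitAddTorus (Fin 2) → ℝ}
    (hsec : ∀ t : ℝ, t ≠ 0 → u t = Torus.twoHalf (v t) (θ t)) :
    longTimeAvgSup (fun t => (Torus.eGradNormSq
        (fun y : UnitAddTorus (Fin 2) => Torus.planarProjE (u t (Torus.planarSect y)))).toReal) =
      longTimeAvgSup (fun t => (Torus.eGradNormSq (v t)).toReal) := by
  refine longTimeAvgSup_congr_of_eqOn_Ioi fun t ht => ?_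
  have hslice : (fun y : UnitAddTorus (Fin 2) => Torus.planarProjE (u t (Torus.planarSect y))) = v t := by
    funext y
    rw [hsec t ht.ne']
    exact Torus.planarProjE_twoHalf_planarSect (v t) (θ t) y
  rw [hslice]

/-- **Eventually `0 ≤ log(1/ν_j)`** along `ν_j → 0`, `ν_j > 0` (eventually `ν_j < 1`). [folklore] -/
theorem eventually_log_inv_nonneg {ν : ℕ → ℝ} (hν : ∀ j, 0 < ν j) (hν0 : Tendsto ν atTop (𝓝 0)) :
    ∀ᶠ j in atTop, 0 ≤ Real.log (ν j)⁻¹ := by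
  filter_upwards [hν0.eventually (gt_mem_nhds one_pos)] with j hj
  exact Real.log_nonneg ((one_le_inv₀ (hν j)).2 hj.le)

/-! ## O-CERT — the witness window -/

/-- **O-CERT `stub_witnessWindow` — THE WITNESS WINDOW in X's language.**  Every X-witness `(f, ν, u₀, u)`
(all hypotheses of `TwohalfdThesis` verbatim) has, for its planar section `v_j = π_E ∘ u_j ∘ ι`:
(i) `c·log(1/ν_j) ≤ ⟨‖∇v_j‖₂⟩` eventually, (ii) `c'·log²(1/ν_j) ≤ ⟨‖∇v_j‖₂²⟩` eventually,
(iii) `⟨‖∇v_j‖₂²⟩ ≤ C ν_j^{-1/2}` for all `j`.  Assembly of O1 `stub_planarSubLogNoGo` and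
O2 `stub_eventualLogStrain` for (i); the reduction `ReductionOffZero.stub_reductionOffZero`, the
identification of the section with the planar flow off `t = 0` and O3 `stub_strainSqLeEnstrophy` (Jensen,
`c' = c²`) for (ii); O4 `stub_planarEnstrophyCeiling` with `K = sup ‖Δg‖`, `E` the planar energy bound and
`C = √(K √E E)` for (iii). [folklore] -/
theorem stub_witnessWindow :
    ∀ f : UnitAddTorus (Fin 3) → EuclideanSpace ℝ (Fin 3),
      (∀ (s : UnitAddCircle) (x : UnitAddTorus (Fin 3)), f (x + Pi.single (2 : Fin 3) s) = f x) →
      Torus.IsSmooth f → Torus.IsDivFree f → Torus.HasZeroMean f →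
      ∀ (ν : ℕ → ℝ) (u₀ : ℕ → UnitAddTorus (Fin 3) → EuclideanSpace ℝ (Fin 3))
        (u : ℕ → ℝ → UnitAddTorus (Fin 3) → EuclideanSpace ℝ (Fin 3)),
        (∀ j, 0 < ν j) → Tendsto ν atTop (𝓝 0) →
        (∀ j, Torus.IsGlobalLerayHopf (ν j) (fun _ => f) (u₀ j) (u j)) →
        (∀ j (t : ℝ) (s : UnitAddCircle) (x : UnitAddTorus (Fin 3)),
          u j t (x + Pi.single (2 : Fin 3) s) = u j t x) →
        (∃ E : ℝ, ∀ j, meanEnergy (u j) ≤ E) →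
        (∃ ε : ℝ, 0 < ε ∧ ∀ j, ε ≤ meanDissipation (ν j) (u j)) →
        (∃ c : ℝ, 0 < c ∧ ∀ᶠ j in atTop, c * Real.log (ν j)⁻¹ ≤
          longTimeAvgSup (fun t => Real.sqrt (Torus.eGradNormSq
            (fun y : UnitAddTorus (Fin 2) => Torus.planarProjE (u j t (Torus.planarSect y)))).toReal)) ∧
        (∃ c : ℝ, 0 < c ∧ ∀ᶠ j in atTop, c * (Real.log (ν j)⁻¹) ^ 2 ≤
          longTimeAvgSup (fun t => (Torus.eGradNormSq
            (fun y : UnitAddTorus (Fin 2) => Torus.planarProjE (u j t (Torus.planarSect y)))).toReal)) ∧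
        (∃ C : ℝ, 0 ≤ C ∧ ∀ j, longTimeAvgSup (fun t => (Torus.eGradNormSq
            (fun y : UnitAddTorus (Fin 2) => Torus.planarProjE (u j t (Torus.planarSect y)))).toReal) ≤
          C * Real.sqrt (ν j)⁻¹) := by
  intro f hfinv hfs hfd hfz ν u₀ u hν hν0 hLH huinv hE hfloor
  -- (i): O1 upgraded to an eventual rate by O2
  obtain ⟨c, hc, hev⟩ :=
    stub_eventualLogStrain stub_planarSubLogNoGo f hfinv hfs hfd hfz ν u₀ u hν hν0 hLH huinv hE hfloor
  -- the reduction to the planar Leray–Hopf flows `v_j` (off `t = 0` the section IS `v_j`)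
  obtain ⟨g, h, v₀, v, θ₀, θ, hgs, -, hgz, -, -, -, hsec, hvLH, -, -, hEv, -, -⟩ :=
    ReductionOffZero.stub_reductionOffZero f hfinv hfs hfd hfz ν u₀ u hν hLH huinv hE
  obtain ⟨E', hE'⟩ := hEv
  have hid : ∀ j, longTimeAvgSup (fun t => (Torus.eGradNormSq
      (fun y : UnitAddTorus (Fin 2) => Torus.planarProjE (u j t (Torus.planarSect y)))).toReal) =
      longTimeAvgSup (fun t => (Torus.eGradNormSq (v j t)).toReal) := fun j =>
    longTimeAvgSup_eGradNormSq_planarSection_eq (hsec j)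
  have hidsqrt : ∀ j, longTimeAvgSup (fun t => Real.sqrt (Torus.eGradNormSq
      (fun y : UnitAddTorus (Fin 2) => Torus.planarProjE (u j t (Torus.planarSect y)))).toReal) =
      longTimeAvgSup (fun t => Real.sqrt (Torus.eGradNormSq (v j t)).toReal) := fun j =>
    longTimeAvgSup_sqrt_eGradNormSq_planarSection_eq (hsec j)
  refine ⟨⟨c, hc, hev⟩, ⟨c ^ 2, by positivity, ?_⟩, ?_⟩
  · -- (ii): Jensen for the honest `limsup` means along `v_j`
    filter_upwards [hev, eventually_log_inv_nonneg hν hν0] with j hj hlog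
    have hO3 := stub_strainSqLeEnstrophy (ν j) g (v₀ j) (v j) (hν j) (hgs.memLp 2) hgz (hvLH j)
    have hcl : 0 ≤ c * Real.log (ν j)⁻¹ := mul_nonneg hc.le hlog
    rw [hid j]
    calc c ^ 2 * (Real.log (ν j)⁻¹) ^ 2 = (c * Real.log (ν j)⁻¹) ^ 2 := by ring
      _ ≤ (longTimeAvgSup (fun t => Real.sqrt (Torus.eGradNormSq
            (fun y : UnitAddTorus (Fin 2) => Torus.planarProjE (u j t (Torus.planarSect y)))).toReal)) ^ 2 :=
          pow_le_pow_left₀ hcl hj 2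
      _ = (longTimeAvgSup (fun t => Real.sqrt (Torus.eGradNormSq (v j t)).toReal)) ^ 2 := by
          rw [hidsqrt j]
      _ ≤ longTimeAvgSup (fun t => (Torus.eGradNormSq (v j t)).toReal) := hO3
  · -- (iii): the Alexakis–Doering ceiling along `v_j`
    obtain ⟨K, hK, hgK⟩ :=
      Torus.exists_nonneg_forall_norm_le_of_continuous hgs.laplacian.continuous
    refine ⟨Real.sqrt (K * (Real.sqrt E' * E')), Real.sqrt_nonneg _, fun j => ?_⟩
    rw [hid j]
    calc longTimeAvgSup (fun t => (Torus.eGradNormSq (v j t)).toReal)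
        ≤ Real.sqrt (K * (Real.sqrt E' * E') / ν j) :=
          stub_planarEnstrophyCeiling (ν j) K E' g (v₀ j) (v j) (hν j) hgs hgz hK hgK (hvLH j) (hE' j)
      _ = Real.sqrt (K * (Real.sqrt E' * E')) * Real.sqrt (ν j)⁻¹ := by
          rw [div_eq_mul_inv, Real.sqrt_mul' _ (inv_nonneg.2 (hν j).le)]

end Summit.AnomalousDissipation.AnomalousDissipation.Theorems.TwohalfdThesis

end
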